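/-
Copyright (c) 2026 the pub-hodgecm-mathlib formalisation cell (harness21).  Prover seat hodgecm-mathlib-F0P3-p01 (g32), Track A «(D-RAM) FOUR-FRAME», unit U2H, census leaf
(ρ2b′-X) — T5b «toric level census, type RamK»: THE INDEX `I(c) = [U_M : B_c]` IN CLOSED FORM (assembly of ★ p857360 ∘ ★ p857378 ∘ ★ p857442).  2026-09-04.
-/
import Literature.NumberTheory.LocalFields.QuadraticOrderNormDepthIndexTwo                -- ★ p857360 (this seat): `[U_M : B_c] = [Ũ : Ṽ_c]∕2` or `[Ũ : Ṽ_c]` by the threshold `2d ≤ c+1`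
import Literature.NumberTheory.LocalFields.QuadraticOrderThetaFixedDepthIndexUnramified  -- ★ p857378 (this seat): `[Ũ : Ṽ_c] = (q+1)q^{⌈c∕2⌉−1}` on the unramified third field
import Literature.NumberTheory.LocalFields.QuadraticDatumNormsOfDoublyFixedUnitsThirdField -- ★ p857442 (this seat): `𝒪_Fˣ ⊆ N` in the two-field frame
import HarnessLib

/-!
# The norm-depth index of type RamK in closed form: `[U_M : B_c] = 1, (q+1)q^{⌈c∕2⌉−1}, (q+1)q^{⌈c∕2⌉−1}∕2` for `c = 0`, `1 ≤ c ≤ 2d−2`, `c ≥ 2d−1`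
(Flicker 1998 Prop. 7 p. 84; Serre, *Local Fields* Ch. V §2 Prop. 3, §3 Cor. 3)

Topic `NumberTheory/LocalFields`; namespace `Literature.NumberTheory.LocalFields.QuadraticOrder`.  THEOREMS ONLY (no definition, no instance, no notation, no named fact, no
`sorry`); kernel lane `--supports stmt-HodgeConjecture-24833` (count-neutral).  Cell `pub/hodgecm-mathlib` (D-0151), crux H413, Track A, unit U2H, census leaf (ρ2b′-X): TYPE RamK
of the toric census (hodgecm-mathlib-F0P3-p01 (g32) T5b memo §2, sheet v4 `idxRK q d c`).  THE TWO-FIELD RamK FRAME (all binders explicit, no definition): `M` = `K` with the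
commuting involutions `ρ` (fixing `E`; `M∕E` UNRAMIFIED: an integer `α` with `|α − ρα| = 1`) and `Θ` (a RAMIFIED quadratic datum `(Θ, ϖ, d, t)` with `ρϖ = ϖ`), complete with finite
residue field; the third field handed over as `K′` (involution `σ′` moving the integer `α′` by a unit, uniformiser `π′`, complete, finite residue field of size `q²`) with
`jK : K′ →+* M` onto `Fix Θ`, `|jK x| = |x|²`, `jK ∘ σ′ = ρ ∘ jK`.  Subgroups of `Mˣ` by membership (★ p857299): `U = {|ω| = 1}`, `Ũ = {Θz = z, |z| = 1}`,
`Ṽ_c = Ũ ∩ {|z − ρz| ≤ exp(−c)}`, `B_c = {|ω| = 1, |ωΘω − ρ(ωΘω)| ≤ exp(−c)}`.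
* **`relIndex_normDepth_eq_of_ramK`** — `B_c.relIndex U = if c = 0 then 1 else if c + 2 ≤ 2d then (q+1)·q^{(c+1)∕2−1} else (q+1)·q^{(c+1)∕2−1} ∕ 2` (= `idxRK q d c` of the T5b sheet).
HONEST LABEL: HC_CM is proved only modulo the 7 printed citations (2 remaining named inputs: hLiu418 = stmt-HodgeConjecture-24832, h413 = stmt-HodgeConjecture-24833) until rung 0
closes; unconditional local algebra, count-neutral (the RamK index organ of T5b; the level tables are separate files).

## References
* [Flicker1998UnitaryFL] Y. Z. Flicker, *Elementary proof of the fundamental lemma for a unitary group*, Canad. J. Math. 50 (1998): Prop. 7 p. 84.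
* [Serre1979] J.-P. Serre, *Local Fields*, GTM 67 (1979): Ch. V §2 Prop. 3, Ch. V §3 Cor. 3.
-/

set_option autoImplicit false

open WithZero IsLocalRing
open scoped Valued
open Literature.NumberTheory.Automorphic.UnitaryThreeFourFrame
open Literature.NumberTheory.LocalFields.WildQuadraticDatum

namespace Literature.NumberTheory.LocalFields.QuadraticOrder

section RamK

variable {K K' : Type} [Field K] [Valued K ℤᵐ⁰] [Field K'] [Valued K' ℤᵐ⁰] {ρ Θ : K →+* K} {α : K} {σ' : K' →+* K'} {α' π' : K'}

/-- **THE TYPE-RamK NORM-DEPTH INDEX IN CLOSED FORM**: `[U_M : B_c] = 1` (`c = 0`), `(q+1)·q^{⌈c∕2⌉−1}` (`1 ≤ c ≤ 2d−2`), `(q+1)·q^{⌈c∕2⌉−1} ∕ 2` (`c ≥ 2d−1`) — the `idxRK q d c`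
of the T5b sheet, in the two-field frame (assembly of ★ `relIndex_normDepth_eq_ite_of_index_two`, ★ `relIndex_thetaFixed_depth_eq_of_unramified`, ★ `exists_mul_map_eq_of_fixed_fixed_of_thirdField`).
[cite: Flicker1998UnitaryFL, Prop. 7 p. 84] [cite: Serre1979, Ch. V §3 Cor. 3] [cite: Serre1979, Ch. V §2 Prop. 3] -/
theorem relIndex_normDepth_eq_of_ramK [CompleteSpace K] [Finite 𝓀[K]] [CompleteSpace K'] [IsDiscreteValuationRing 𝒪[K']] [Finite 𝓀[K']]
    (hρρ : ∀ x, ρ (ρ x) = x) (hvρ : ∀ x, Valued.v (ρ x) = Valued.v x) (hα1 : Valued.v α ≤ 1) (hδ : Valued.v (α - ρ α) = 1)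
    (hΘρ : ∀ x, Θ (ρ x) = ρ (Θ x)) {ϖ : K} {d t : ℕ} (hD : IsRamifiedQuadraticDatum Θ ϖ d t) (hρϖ : ρ ϖ = ϖ)
    (hσ' : ∀ x, σ' (σ' x) = x) (hvσ' : ∀ x, Valued.v (σ' x) = Valued.v x) (hα'1 : Valued.v α' ≤ 1) (hα' : Valued.v (α' - σ' α') = 1)
    (hπ' : Valued.v π' = exp (-1 : ℤ)) {q : ℕ} (hq : Nat.card 𝓀[K'] = q ^ 2)
    (jK : K' →+* K) (hjv : ∀ x, Valued.v (jK x) = Valued.v x ^ 2) (hjΘ : ∀ x, Θ (jK x) = jK x) (hjfix : ∀ z : K, Θ z = z → ∃ x, jK x = z)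
    (hjσ : ∀ x, jK (σ' x) = ρ (jK x))
    (c : ℕ) (U Ut Vt B : Subgroup Kˣ) (hU : ∀ u, u ∈ U ↔ Valued.v (u : K) = 1)
    (hUt : ∀ z, z ∈ Ut ↔ Θ (z : K) = z ∧ Valued.v (z : K) = 1)
    (hVt : ∀ z, z ∈ Vt ↔ Θ (z : K) = z ∧ Valued.v (z : K) = 1 ∧ Valued.v ((z : K) - ρ z) ≤ exp (-(c : ℤ)))
    (hB : ∀ ω, ω ∈ B ↔ Valued.v (ω : K) = 1 ∧ Valued.v ((ω : K) * Θ ω - ρ ((ω : K) * Θ ω)) ≤ exp (-(c : ℤ))) :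
    B.relIndex U = if c = 0 then 1 else if c + 2 ≤ 2 * d then (q + 1) * q ^ ((c + 1) / 2 - 1) else (q + 1) * q ^ ((c + 1) / 2 - 1) / 2 := by
  have hFN : ∀ f : K, ρ f = f → Θ f = f → Valued.v f = 1 → ∃ x : K, x * Θ x = f := fun f hρf hΘf hf =>
    exists_mul_map_eq_of_fixed_fixed_of_thirdField hρρ hvρ hΘρ hD hσ' hvσ' hα'1 hα' hπ' jK hjv hjΘ hjfix hjσ hρf hΘf hf
  rw [relIndex_normDepth_eq_ite_of_index_two hρρ hvρ hα1 hδ hΘρ hD hρϖ hFN c U Ut Vt B hU hUt hVt hB]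
  rcases Nat.eq_zero_or_pos c with rfl | hc
  · -- `c = 0`: `Ṽ_0 = Ũ`, and `2d ≤ 1` fails (`d ≥ 1`)
    have hd := hD.2.2.2.2.2.1
    have hVU : Vt = Ut := by
      ext z
      rw [hVt, hUt, Nat.cast_zero, neg_zero, exp_zero]
      constructor
      · rintro ⟨h1, h2, -⟩; exact ⟨h1, h2⟩
      · rintro ⟨h1, h2⟩
        refine ⟨h1, h2, (Valuation.map_sub _ _ _).trans (max_le h2.le ?_)⟩
        rw [hvρ]; exact h2.le
    have h' : ¬ (2 * d ≤ 0 + 1) := by omega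
    rw [hVU, Subgroup.relIndex_self, if_neg h', if_pos rfl]
  · have hc0 : c ≠ 0 := by omega
    rw [relIndex_thetaFixed_depth_eq_of_unramified hσ' hvσ' hα'1 hα' hπ' hq jK hjv hjΘ hjfix hjσ hc Ut Vt hUt hVt]
    by_cases h : 2 * d ≤ c + 1
    · have h' : ¬ (c + 2 ≤ 2 * d) := by omega
      simp only [if_pos h, if_neg hc0, if_neg h']
    · have h' : c + 2 ≤ 2 * d := by omega
      simp only [if_neg h, if_neg hc0, if_pos h']

end RamK

end Literature.NumberTheory.LocalFields.QuadraticOrder
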